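import Literature.NumberTheory.EllipticCurves.DeligneSerreCompanionAuxiliaryLevelProofs
import Literature.NumberTheory.EllipticCurves.CuspFormLFunctionMeanSquareNonvanishingProofs
import Literature.NumberTheory.EllipticCurves.PAdicLFunctionDistributionProofs
import Literature.NumberTheory.EllipticCurves.PAdicLFunctionNeZeroProofs
import Literature.NumberTheory.EllipticCurves.Rank1Residual.Predicates
import HarnessLib

/-!
# Crux `KobayashiLowerHalfLargeImage` (item stmt-BirchSwinnertonDyer-19001), idea `edge-seed-rigidity`:
# its first stub `stub_companionEdge` AT `p = 3` — a weight-`4` COMPANION NEWFORM `g ≡ f_E (mod 𝔭)`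
# with `L(g, 3) ≠ 0` — for EVERY curve good at `3`, at the AUXILIARY level `2N_E`

HONEST FRAMING (D-0152). Route K3 = `SignedLowerHalves` is a CLASS route; crux 3
(`Theses.SignedLowerHalves.KobayashiLowerHalfLargeImage`) is the Eisenstein half of Kobayashi's signed
main conjecture on the large-image corner of X7. NOTHING here proves the crux, the route, or BSD. This
file is a HELPER of item 19001 (`--supports`): it complements
`…LargeImageEdgeSeedCompanion.lean` (w2 g4: `stub_companionEdge` at every `p ≥ 5`, where the
weight-`(p+1)` companion comes from the level-one Eisenstein series `E_{p-1} ≡ 1 (mod p)`). At `p = 3`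
the companion has weight `4 = 2 + 2` and `E₂` is not modular; the device of this file is the
AUXILIARY PRIME `2`: Mazur's weight-`2` Eisenstein series `-(E₂(z) - 2E₂(2z))` of level `2` has
`q`-expansion `1 + 24 ∑ (σ₁(n) - 2[2 ∣ n]σ₁(n/2)) qⁿ ≡ 1 (mod 3)`, and the Deligne–Serre pipeline run at
level `2N_E` with the Hecke operators AWAY from `2N_E` gives a congruent newform of weight `4` and level
dividing `2N_E` — for EVERY elliptic curve good at `3`, with no condition on the primes of `N_E`
(`ModularForms.exists_isNewform0_dvd_two_mul_level_congr_weight_add_two_three`,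
`Literature/…/DeligneSerreCompanionAuxiliaryLevelProofs.lean`). Inputs, all PROVED in the tree: that
theorem; the modularity dictionary `a_ℓ(f_E) = a_ℓ(E)` (`IsNewformOf`,
`LFunction_apply_prime_eq_frobeniusTrace`), `3 ∤ N_E` (`not_dvd_level_of_isNewformOf`), `ℓ ∤ N ⇒`
good at `ℓ` (`hasGoodReductionAtPrime_of_not_dvd_conductorNorm`), `T_ℓ g = a_ℓ(g) g`
(`IsNewform0.heckeEigenvalue_eq_coeff_holds`), `ℚ̄₃ ≃ ℂ` (`PadicAlgCl.nonempty_ringEquiv_complex`);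
and, for the edge value, `IsNewform0.cuspFormLSeries_edge_ne_zero` (`L(g, k-1) ≠ 0` for `k ≥ 4`,
UNCONDITIONAL: Rankin's mean-square half-plane `re s > (k+1)/2`, seat w8's
`CuspFormLFunctionMeanSquareNonvanishingProofs`, p648359) — at `p = 3` the edge `s = 3` of the weight-`4`
strip lies on Hecke's boundary `re s = k/2 + 1`, outside the Euler-product half-plane used at `p ≥ 5`,
but inside Rankin's.

## Statements

* `exists_companion_weight_four_three_of_isNewformOf` — UNCONDITIONAL: for `W/ℚ` globally minimal with
  good reduction at `3` and `f` its newform, there are `M ∣ 2N_W` with `3 ∤ M`, a newform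
  `g ∈ S_4(Γ₀(M))` and `ι : ℚ̄₃ ≃ ℂ` with `‖ι⁻¹ a_ℓ(g) − a_ℓ(W)‖₃ < 1` for every prime `ℓ ∤ 2N_W`.
* `exists_companionEdge_three_auxLevel_of_isNewformOf` — the same with `L(g, 3) ≠ 0` (unconditional).
* `exists_companionEdge_three_auxPrime_of_isNewformOf` (appendix) — the same with the auxiliary prime `2`
  replaced by ANY prime `ℓ ≡ 2 (mod 3)`: level dividing `ℓ N_W`, congruence off `ℓ N_W`, `L(g, 3) ≠ 0`.
* `stub_companionEdge_three_auxLevel_of_exists_isNewformOf` — the ideator's stub shape at `p = 3`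
  (evidence `Sketch.lean` of item 19001; definitions unfolded as in w2 g4's file) with TWO honest
  changes: the companion's level divides `2 N_W` (not `N_W`), and the congruence is asserted at the
  primes `ℓ ∤ 6 M N_W` (not `ℓ ∤ 3 M N_W`); GRANTED Modularity (`exists_isNewformOf`) only.

## What is NOT proved here (said, not hidden)

* The ideator's LITERAL `stub_companionEdge` at `p = 3` asks for a level `M ∣ N_W`. On the population
  «`N_W` has a prime factor `q` with `3 ∤ q − 1`» that is the lane of seat w5 (multiplier
  `E₂^{(q)}/(1 − q)` at level `N_W`; the Literature file also carries the newform-level statement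
  `exists_isNewform0_dvd_level_congr_weight_add_two_three_of_prime_dvd`); on the complementary population
  (every prime of `N_W` is `≡ 1 (mod 3)`) a level dividing `N_W` needs Katz's lift of the Hasse invariant
  (geometric mod-`p` forms), absent from the tree — there this file's level `∣ 2N_W` is what exists.
* Nothing about the ENGINE S2–S5 of the line (Harder congruence / height-`p` lattice / Kato edge rigidity
  / Fouquet transport): not in print at these parameters, not typed (D1/D2). Whether a `2`-old or `2`-new
  companion level is acceptable to that engine is for the line's author; this file only supplies S1-type
  companions. Calibration of S1 at `p = 3` only.

References: Deligne–Serre 1974, 6.9–6.11 [DeligneSerreASENS1974]; Diamond–Shurman GTM 228, §1.2,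
Thm. 5.8.3, Thm. 5.9.2 [DiamondShurman2005]; Mazur 1977, II.5 [Mazur1977]; Rankin 1977, Thm. 4.5.2 [Rankin1977];
Breuil–Conrad–Diamond–Taylor 2001, Thm. A [BreuilConradDiamondTaylor2001]; crux workfiles
`Cruxes/KobayashiLowerHalfLargeImage/{Ideas/edge-seed-rigidity.md, Lines/edge_seed_rigidity.md}`.
-/

set_option autoImplicit false
set_option linter.dupNamespace false

noncomputable section

open scoped MatrixGroups ModularForm

open CongruenceSubgroup UpperHalfPlane WeierstrassCurve
  Literature.NumberTheory.EllipticCurves Literature.NumberTheory.EllipticCurves.ModularForms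
  Literature.NumberTheory.EllipticCurves.Rank1Residual

namespace Summit.BirchSwinnertonDyer.BirchSwinnertonDyer.Theorems.EdgeSeedRigidity

/-- **A weight-`4` companion of `f_E` modulo `3`, at level dividing `2N_E`** (unconditional). Let `W/ℚ`
be a globally minimal elliptic curve of conductor `N` with good reduction at `3` and `f ∈ S_2(Γ₀(N))` its
newform (`IsNewformOf W f`). Then there are `M ∣ 2N` with `3 ∤ M`, a newform `g ∈ S_4(Γ₀(M))` and a field
isomorphism `ι : ℚ̄₃ ≃ ℂ` with `‖ι⁻¹(a_ℓ(g)) − a_ℓ(W)‖₃ < 1` for every prime `ℓ ∤ 2N` (`a_ℓ(g)` the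
`T_ℓ`-eigenvalue, `a_ℓ(W)` the Frobenius trace). Deligne–Serre with the multiplier
`-(E₂(z) - 2E₂(2z)) ≡ 1 (mod 3)` at the auxiliary level `2N`
(`exists_isNewform0_dvd_two_mul_level_congr_weight_add_two_three`) and the modularity dictionary.
[cite: DeligneSerreASENS1974, 6.9–6.11] [cite: DiamondShurman2005, §1.2 and Thm. 5.8.3] -/
theorem exists_companion_weight_four_three_of_isNewformOf [Fact (3 : ℕ).Prime] (W : WeierstrassCurve ℚ)
    [W.IsElliptic] [W.IsGloballyMinimal] [NeZero (W.conductorNorm ℤ)]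
    (hgood : W.HasGoodReductionAtPrime 3)
    {f : CuspForm (Gamma0 (W.conductorNorm ℤ)) 2} (hf : IsNewformOf W f) :
    ∃ (M : ℕ) (_ : NeZero M) (_ : M ∣ 2 * W.conductorNorm ℤ) (g : CuspForm (Gamma0 M) 4)
      (ι : PadicAlgCl 3 ≃+* ℂ),
      IsNewform0 g ∧ ¬ 3 ∣ M ∧
      (∀ ℓ : ℕ, ℓ.Prime → ¬ ℓ ∣ 2 * W.conductorNorm ℤ →
        ‖ι.symm (heckeEigenvalue g ℓ) - ((W.frobeniusTrace ℓ : ℤ) : PadicAlgCl 3)‖ < 1) := by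
  -- an abstract field isomorphism `ℚ̄₃ ≃ ℂ`
  obtain ⟨ι⟩ := PadicAlgCl.nonempty_ringEquiv_complex 3
  -- good reduction at `3` forces `3 ∤ N`, hence `3 ∤ 2N`
  have h3N : ¬ 3 ∣ W.conductorNorm ℤ := not_dvd_level_of_isNewformOf hf hgood
  have h3N2 : ¬ 3 ∣ 2 * W.conductorNorm ℤ := by
    intro h
    rcases (Nat.Prime.dvd_mul Nat.prime_three).mp h with h2 | hN
    · exact absurd h2 (by norm_num)
    · exact h3N hN
  -- Deligne–Serre at the auxiliary level `2N`: the congruent newform of weight `2 + 2` and level `M ∣ 2N`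
  obtain ⟨M, hM, hMN, g, hg, hcong⟩ :=
    exists_isNewform0_dvd_two_mul_level_congr_weight_add_two_three ι le_rfl hf.1
  have hk : (2 : ℤ) + 2 = 4 := by norm_num
  rw [← hk]
  refine ⟨M, hM, hMN, g, ι, hg, fun h => h3N2 (h.trans hMN), fun ℓ hℓ hℓN => ?_⟩
  -- the modularity dictionary at the good prime `ℓ ∤ N`: `a_ℓ(f) = a_ℓ(W)`
  haveI : Fact ℓ.Prime := ⟨hℓ⟩
  have hℓN' : ¬ ℓ ∣ W.conductorNorm ℤ := fun h => hℓN (h.mul_left 2)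
  have hgoodℓ : W.HasGoodReductionAtPrime ℓ :=
    hasGoodReductionAtPrime_of_not_dvd_conductorNorm W hℓN'
  have hfℓ : (qExpansion 1 ⇑f).coeff ℓ = ((W.frobeniusTrace ℓ : ℤ) : ℂ) := by
    rw [← WeierstrassCurve.LFunction_apply_prime_eq_frobeniusTrace W ℓ hgoodℓ]
    exact hf.2 ℓ
  have h := hcong ℓ hℓ hℓN
  rw [hfℓ, map_intCast] at h
  -- `T_ℓ g = a_ℓ(g) g` for the newform `g`
  rw [IsNewform0.heckeEigenvalue_eq_coeff_holds hg hℓ]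
  exact h

/-- **The EDGE companion at `p = 3`, at level dividing `2N_E`** (unconditional): for `W/ℚ` globally
minimal with good reduction at `3` and `f` its newform, there are `M ∣ 2N_W` with `3 ∤ M`, a newform
`g ∈ S_4(Γ₀(M))` congruent to `f` modulo `𝔪_{ℚ̄₃}` at every prime `ℓ ∤ 2N_W` (through some
`ι : ℚ̄₃ ≃ ℂ`), and `L(g, 3) ≠ 0` — the last critical value of the weight-`4` form, on Hecke's boundary
`re s = k/2 + 1 = 3`, inside Rankin's half-plane `re s > (k+1)/2 = 5/2` where the tree's
`IsNewform0.cuspFormLSeries_edge_ne_zero` gives non-vanishing with NO named fact.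
[cite: DeligneSerreASENS1974, 6.9–6.11] [cite: DiamondShurman2005, §1.2 and Thm. 5.8.3]
[cite: Rankin1977, Thm. 4.5.2] -/
theorem exists_companionEdge_three_auxLevel_of_isNewformOf [Fact (3 : ℕ).Prime] (W : WeierstrassCurve ℚ)
    [W.IsElliptic] [W.IsGloballyMinimal] [NeZero (W.conductorNorm ℤ)]
    (hgood : W.HasGoodReductionAtPrime 3)
    {f : CuspForm (Gamma0 (W.conductorNorm ℤ)) 2} (hf : IsNewformOf W f) :
    ∃ (M : ℕ) (_ : NeZero M) (_ : M ∣ 2 * W.conductorNorm ℤ) (g : CuspForm (Gamma0 M) 4)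
      (ι : PadicAlgCl 3 ≃+* ℂ),
      IsNewform0 g ∧ ¬ 3 ∣ M ∧
      (∀ ℓ : ℕ, ℓ.Prime → ¬ ℓ ∣ 2 * W.conductorNorm ℤ →
        ‖ι.symm (heckeEigenvalue g ℓ) - ((W.frobeniusTrace ℓ : ℤ) : PadicAlgCl 3)‖ < 1) ∧
      cuspFormLSeries g (3 : ℂ) ≠ 0 := by
  obtain ⟨M, hM, hMN, g, ι, hg, h3M, hcong⟩ :=
    exists_companion_weight_four_three_of_isNewformOf W hgood hf
  refine ⟨M, hM, hMN, g, ι, hg, h3M, hcong, ?_⟩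
  -- `L(g, k - 1) ≠ 0` for `k = 4`, i.e. `L(g, 3) ≠ 0` (Rankin's half-plane, unconditional)
  have h := IsNewform0.cuspFormLSeries_edge_ne_zero hg le_rfl
  have h3 : ((4 : ℤ) : ℂ) - 1 = (3 : ℂ) := by push_cast; norm_num
  rwa [h3] at h

/-- **`stub_companionEdge` of the line card `Lines/edge_seed_rigidity.md` AT `p = 3`, at the auxiliary
level, granted the Modularity Theorem.** The ideator's stub (evidence `Sketch.lean` of
item 19001, crux-ideate k1 g14) reads `∀ W p, p ≠ 2 → ClassX7 W p → a_p = 0 → Surj W p → ∃ M g,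
IsCompanionForm p W g ∧ L(g, p) ≠ 0`, `IsCompanionForm p W g := IsNewform0 g ∧ ¬ p ∣ M ∧ M ∣ N_W ∧
IsCongruentFormModP p W g`, `IsCongruentFormModP p W g := ∃ (ι : ℚ̄_p →+* ℂ) (b : ℕ → ℚ̄_p), ∀ ℓ prime,
ℓ ∤ p·M·N_W → ι (b ℓ) = heckeEigenvalue g ℓ ∧ ‖b ℓ − a_ℓ(W)‖ < 1`. Here `p = 3`, the definitions are
UNFOLDED (they are not tree definitions), and TWO clauses are honestly WEAKENED: the companion's level
divides `2 N_W` (auxiliary prime `2`; a level dividing `N_W` for EVERY curve would need Katz's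
Hasse-invariant lift, absent from the tree), and the congruence is asserted at the primes
`ℓ ∤ 6 M N_W`. The only input beyond proved theorems is the named fact `exists_isNewformOf`
(Breuil–Conrad–Diamond–Taylor 2001, Thm. A; the stub does not name the newform of `W`); `L(g, 3) ≠ 0` is
unconditional (`IsNewform0.cuspFormLSeries_edge_ne_zero`). `ClassX7 W 3` is used only through good
reduction at `3`; the displayed `a_3 = 0`, `Surj W 3` are idle (S1 does not need them). CONDITIONAL on
`hmod` only; calibration of S1 — the line's engine S2 is not in print.
[cite: BreuilConradDiamondTaylor2001, Thm. A] [cite: DeligneSerreASENS1974, 6.9–6.11]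
[cite: DiamondShurman2005, §1.2 and Thm. 5.8.3] [cite: Rankin1977, Thm. 4.5.2] -/
theorem stub_companionEdge_three_auxLevel_of_exists_isNewformOf [Fact (3 : ℕ).Prime]
    (hmod : exists_isNewformOf) :
    ∀ (W : WeierstrassCurve ℚ) [W.IsElliptic] [W.IsGloballyMinimal],
      ClassX7 W 3 → W.frobeniusTrace 3 = 0 → Surj W 3 →
      ∃ (M : ℕ) (_ : NeZero M) (g : CuspForm (Gamma0 M) ((3 : ℤ) + 1)),
        (IsNewform0 g ∧ ¬ (3 ∣ M) ∧ M ∣ 2 * W.conductorNorm ℤ ∧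
          ∃ (ι : PadicAlgCl 3 →+* ℂ) (b : ℕ → PadicAlgCl 3),
            ∀ ℓ : ℕ, ℓ.Prime → ¬ (ℓ ∣ 6 * M * W.conductorNorm ℤ) →
              ι (b ℓ) = heckeEigenvalue g ℓ ∧
                ‖b ℓ - (W.frobeniusTrace ℓ : PadicAlgCl 3)‖ < 1) ∧
        cuspFormLSeries g (3 : ℂ) ≠ 0 := by
  intro W _ _ hX _ _
  haveI : NeZero (W.conductorNorm ℤ) := ⟨(W.conductorNorm_pos_holds : 0 < W.conductorNorm ℤ).ne'⟩
  -- modularity: the newform `f_W`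
  obtain ⟨f, hf⟩ := hmod W
  obtain ⟨M, hM, hMN, g, ι, hg, h3M, hcong, hL⟩ :=
    exists_companionEdge_three_auxLevel_of_isNewformOf W hX.1.1 hf
  have hk : (3 : ℤ) + 1 = 4 := by norm_num
  rw [hk]
  refine ⟨M, hM, g, ⟨hg, h3M, hMN, (ι : PadicAlgCl 3 →+* ℂ), fun ℓ => ι.symm (heckeEigenvalue g ℓ),
    fun ℓ hℓ hℓ6MN => ⟨?_, ?_⟩⟩, hL⟩
  · -- `ι (ι⁻¹ a_ℓ(g)) = a_ℓ(g)`
    exact ι.apply_symm_apply _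
  · -- `ℓ ∤ 6·M·N ⇒ ℓ ∤ 2N`
    refine hcong ℓ hℓ fun h => hℓ6MN ?_
    have h' : 2 * W.conductorNorm ℤ ∣ 6 * M * W.conductorNorm ℤ :=
      ⟨3 * M, by ring⟩
    exact h.trans h'

/-! ### Appendix: an arbitrary auxiliary prime `ℓ ≡ 2 (mod 3)` in place of `2` -/

/-- `‖24‖₃ · ‖1 - ℓ‖₃⁻¹ < 1` for a prime `ℓ ≡ 2 (mod 3)` (then `3 ∤ ℓ - 1`). [folklore] -/
private theorem norm_twentyFour_div_lt_one_of_mod_three [Fact (3 : ℕ).Prime] {ℓ : ℕ}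
    (hℓ3 : ℓ % 3 = 2) : ‖(24 : PadicAlgCl 3) / (1 - (ℓ : PadicAlgCl 3))‖ < 1 := by
  have h24 : ‖(24 : PadicAlgCl 3)‖ < 1 := by
    have h : ‖((24 : ℤ) : PadicAlgCl 3)‖ < 1 := by
      rw [← map_intCast (algebraMap ℚ_[3] (PadicAlgCl 3)) 24]
      change ‖(((24 : ℤ) : ℚ_[3]) : PadicAlgCl 3)‖ < 1
      rw [PadicAlgCl.norm_extends]
      exact Padic.norm_intCast_lt_one_iff.2 ⟨8, by norm_num⟩
    exact_mod_cast h
  have hnd : ¬ (3 : ℤ) ∣ 1 - (ℓ : ℤ) := by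
    rintro ⟨c, hc⟩
    omega
  have hden : ‖(1 : PadicAlgCl 3) - (ℓ : PadicAlgCl 3)‖ = 1 := by
    have h := DeligneSerreLift.norm_intCast_eq_one_of_not_dvd (p := 3) (z := 1 - (ℓ : ℤ)) hnd
    push_cast at h
    exact h
  rw [norm_div, hden, div_one]
  exact h24

/-- **A weight-`4` companion of `f_E` modulo `3` at level dividing `ℓ N_E`, for ANY auxiliary prime
`ℓ ≡ 2 (mod 3)`** (unconditional; `ℓ = 2` is `exists_companionEdge_three_auxLevel_of_isNewformOf`). Let
`W/ℚ` be globally minimal with good reduction at `3`, `f` its newform and `ℓ` a prime with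
`ℓ ≡ 2 (mod 3)`. Then there are `M ∣ ℓ N_W` with `3 ∤ M`, a newform `g ∈ S_4(Γ₀(M))` and
`ι : ℚ̄₃ ≃ ℂ` with `‖ι⁻¹(a_q(g)) − a_q(W)‖₃ < 1` for every prime `q ∤ ℓ N_W`, and `L(g, 3) ≠ 0`. The
multiplier is Mazur's `E₂^{(ℓ)}/(1 − ℓ)` (`‖24/(1 − ℓ)‖₃ = 1/3`), the pipeline
`exists_isNewform0_dvd_level_congr_of_mazurMultiplier` at the level `ℓ N_W`; the freedom in `ℓ` (odd,
prime to `N_W`, in a prescribed class …) is left to the consumer (e.g. a paramodular level for the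
line's engine S2). [cite: DeligneSerreASENS1974, 6.9–6.11] [cite: DiamondShurman2005, §1.2 and Thm. 5.8.3]
[cite: Rankin1977, Thm. 4.5.2] -/
theorem exists_companionEdge_three_auxPrime_of_isNewformOf [Fact (3 : ℕ).Prime]
    (W : WeierstrassCurve ℚ) [W.IsElliptic] [W.IsGloballyMinimal] [NeZero (W.conductorNorm ℤ)]
    (hgood : W.HasGoodReductionAtPrime 3)
    {f : CuspForm (Gamma0 (W.conductorNorm ℤ)) 2} (hf : IsNewformOf W f)
    {ℓ : ℕ} (hℓ : ℓ.Prime) (hℓ3 : ℓ % 3 = 2) :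
    ∃ (M : ℕ) (_ : NeZero M) (_ : M ∣ ℓ * W.conductorNorm ℤ) (g : CuspForm (Gamma0 M) 4)
      (ι : PadicAlgCl 3 ≃+* ℂ),
      IsNewform0 g ∧ ¬ 3 ∣ M ∧
      (∀ q : ℕ, q.Prime → ¬ q ∣ ℓ * W.conductorNorm ℤ →
        ‖ι.symm (heckeEigenvalue g q) - ((W.frobeniusTrace q : ℤ) : PadicAlgCl 3)‖ < 1) ∧
      cuspFormLSeries g (3 : ℂ) ≠ 0 := by
  obtain ⟨ι⟩ := PadicAlgCl.nonempty_ringEquiv_complex 3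
  haveI : NeZero (ℓ * W.conductorNorm ℤ) := ⟨mul_ne_zero hℓ.ne_zero (NeZero.ne _)⟩
  -- `3 ∤ N`, `3 ∤ ℓ`, hence `3 ∤ ℓ N`
  have h3N : ¬ 3 ∣ W.conductorNorm ℤ := not_dvd_level_of_isNewformOf hf hgood
  have h3ℓ : ¬ 3 ∣ ℓ := by
    intro h
    omega
  have h3ℓN : ¬ 3 ∣ ℓ * W.conductorNorm ℤ := by
    intro h
    rcases (Nat.Prime.dvd_mul Nat.prime_three).mp h with h1 | h2
    · exact h3ℓ h1
    · exact h3N h2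
  -- Deligne–Serre with the multiplier `E₂^{(ℓ)}/(1 - ℓ)` at the level `ℓ N`
  obtain ⟨M, hM, hMN, g, hg, hcong⟩ :=
    exists_isNewform0_dvd_level_congr_of_mazurMultiplier ι (N := W.conductorNorm ℤ)
      (N' := ℓ * W.conductorNorm ℤ) (Dvd.intro_left ℓ rfl) hℓ (Dvd.intro _ rfl) (by norm_num)
      (norm_twentyFour_div_lt_one_of_mod_three hℓ3) le_rfl hf.1
  have hk : (2 : ℤ) + 2 = 4 := by norm_num
  rw [← hk]
  refine ⟨M, hM, hMN, g, ι, hg, fun h => h3ℓN (h.trans hMN), fun q hq hqN => ?_, ?_⟩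
  · -- the modularity dictionary at the good prime `q ∤ N`
    haveI : Fact q.Prime := ⟨hq⟩
    have hqN' : ¬ q ∣ W.conductorNorm ℤ := fun h => hqN (h.mul_left ℓ)
    have hgoodq : W.HasGoodReductionAtPrime q :=
      hasGoodReductionAtPrime_of_not_dvd_conductorNorm W hqN'
    have hfq : (qExpansion 1 ⇑f).coeff q = ((W.frobeniusTrace q : ℤ) : ℂ) := by
      rw [← WeierstrassCurve.LFunction_apply_prime_eq_frobeniusTrace W q hgoodq]
      exact hf.2 q
    have h := hcong q hq hqN
    rw [hfq, map_intCast] at h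
    rw [IsNewform0.heckeEigenvalue_eq_coeff_holds hg hq]
    exact h
  · -- `L(g, 3) ≠ 0` (Rankin's half-plane, unconditional)
    have h := IsNewform0.cuspFormLSeries_edge_ne_zero hg le_rfl
    have h3 : (((2 : ℤ) + 2 : ℤ) : ℂ) - 1 = (3 : ℂ) := by push_cast; norm_num
    rwa [h3] at h

end Summit.BirchSwinnertonDyer.BirchSwinnertonDyer.Theorems.EdgeSeedRigidity

end
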